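import Summits.BirchSwinnertonDyer.BirchSwinnertonDyer.Theorems.SignedLowerHalvesSprungLowerDivisibilityAtThreeSharpFlatMordellWeilRank
import Literature.NumberTheory.EllipticCurves.Kim2025.MainIdentityAtAugmentationOPEN
import Literature.NumberTheory.EllipticCurves.SkinnerUrban2014.ShaOrderOfMainConjectureProofs
import Literature.NumberTheory.EllipticCurves.Kato2004.MainConjectureSkeletonProofs
import Literature.NumberTheory.EllipticCurves.ModularFormsGamma0Genus
import Literature.NumberTheory.EllipticCurves.ModularCurvePeriodRatio
import Mathlib.RingTheory.Ideal.Height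
import HarnessLib

/-!
# Crux K1 `SprungLowerDivisibilityAtThree` (item stmt-BirchSwinnertonDyer-19875), line `chromatic-common-zeros`:
# stub S4 at the prime `(T)` for EVERY rank — the Eisenstein inequality at `(T)` for a colour whose `T`-adic
# order does not exceed the Mordell–Weil rank (GZK-free, Kato-free; a per-pair door for S4b's `(T)`-part)

Cell `bsd-ssimc` (host) / lead `cruxlead-stmt-BirchSwinnertonDyer-19875`, width seat w3; `--supports` 19875 (helper);
theorems only; closes NO item; K1 / BSD / leaf X8 are NOT proved by anything here.

## What this file proves

Stub S4 (`stub_cyclotomicLower`, skeleton v3: S4a at `(T) ∧ r_an ≤ 1` landed p608649; S4b = the rest, OPEN) asks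
at a cyclotomic common height-one prime `𝔭` for `ℓ_𝔭 Λ/(G^•) ≤ ℓ_𝔭 X^•`. At `𝔭 = (T)` the left side is
`ord_{T=0} L^•` (`lengthAt_quotient_primeT_eq_order_chromaticL`: `Λ/(G^•)` is cyclic torsion with `char = (G^•)`,
`Kim2025.lengthAt_primeT_eq_order_of_charIdeal_eq_span`; `ι` and the non-zero constant `C(ϖ)` preserve `ord_T`),
and the right side is at least `rank E(ℚ)` by the KUMMER brick of this line
(`ChromaticCommonZeros.rat_mordellWeilRank_le_sharpFlat_lengthAt_primeT`, p608535: `E(ℚ) ⊗ ℚ_p/ℤ_p ↪ Sel^•(E/ℚ_∞)^Γ`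
up to finite kernel, because `Ker Col^•` kills `E(ℚ_p)`; no control theorem, no `L`-value). Hence:

* `stub_cyclotomicLower_at_T_of_order_le_rank` — **at EVERY analytic rank**, for a colour `•` with
  `ord_{T=0} L^• ≤ rank E(ℚ)` (displayed, per pair: finitely many coefficients of `L^•` and that many independent
  rational points), S4's inequality at every height-one `𝔭 ∋ T` holds for Sprung's REAL dual datum `D` of colour
  `•` (binders: `p ≠ 2`, `p ∣ a_p`, the cyclotomic/Honda data, `X^•` finitely generated; NO torsion, NO GZK, NO
  period unit, NO Kato divisibility, NO certificate on `λ`). With the line's colour transfer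
  (`SharpFlatColemanKatoData.colour_transfer`, p607724) the same follows for the other colour. This subsumes the
  Selmer side of S4a at `r_an = 1` (there `ord_T L^∘ = 1 ≤ 1 = rank`, GZK only to produce the point) and opens
  S4b's `(T)`-part per pair at `r_an ≥ 2`: `p`-adic BSD predicts `min_• ord_T L^• = rank E(ℚ)`, so the
  hypothesis is expected to be certifiable on every pair by exhibiting `rank` independent points and one non-zero
  coefficient of index `≤ rank` of one colour.

Honest status: a door, not a theorem about any class; the hypothesis `ord_T L^• ≤ rank E(ℚ)` is the `p`-adic
BSD-type input and is NOT proved here.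

References: [GreenbergLNM1716] §1 p. 65, §3 Lemma 3.1; [Sprung2012] Def. 7.11 (p. 1503), Prop. 7.19 (p. 1505);
[Sprung2024] §5.2 p. 39; [Washington1997] §13.2; [BernardiPerrinRiou1993] / [Sprung2015] Conj. 4.7–4.8 (the
`p`-adic BSD rank prediction, context only).
-/

set_option linter.dupNamespace false
set_option autoImplicit false

noncomputable section

open scoped Classical NumberField MatrixGroups ModularForm

open NumberField IsDedekindDomain CongruenceSubgroup WeierstrassCurve Field
  Literature.NumberTheory.EllipticCurves Literature.NumberTheory.EllipticCurves.ModularForms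
  Literature.NumberTheory.EllipticCurves.IwasawaAlgebra Literature.NumberTheory.EllipticCurves.ZpExtension
  Literature.NumberTheory.EllipticCurves.Sprung2017 Literature.NumberTheory.EllipticCurves.Sprung2012
  Summit.BirchSwinnertonDyer.BirchSwinnertonDyer.Theorems

namespace Summit.BirchSwinnertonDyer.BirchSwinnertonDyer.Theorems.ChromaticCommonZerosOrderLeRank

variable (p : ℕ) [Fact p.Prime]

/-! ### §1 `ℓ_{(T)} Λ/(G^•) = ord_{T=0} L^•` for a Néron-normalised `G^•` -/

/-- `ord_{T=0}(C(c) · φ) = ord_{T=0} φ` for a non-zero constant `c` (coefficientwise). [folklore] -/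
theorem order_C_mul_of_ne_zero {c : ℚ_[p]} (hc : c ≠ 0) (φ : PowerSeries ℚ_[p]) :
    (PowerSeries.C c * φ).order = φ.order := by
  refine le_antisymm ?_ ?_
  · refine PowerSeries.le_order _ _ fun i hi => ?_
    have h := PowerSeries.coeff_of_lt_order i hi
    rw [PowerSeries.coeff_C_mul, mul_eq_zero] at h
    exact h.resolve_left hc
  · refine PowerSeries.le_order _ _ fun i hi => ?_
    rw [PowerSeries.coeff_C_mul, PowerSeries.coeff_of_lt_order i hi, mul_zero]

/-- **`ℓ_{(T)} Λ/(G) = ord_{T=0} L^•`** for `G ∈ Λ` with `ι G = C(ϖ)·ι L^•`, `ϖ ≠ 0`, `L^• ≠ 0`: `Λ/(G)` is a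
cyclic torsion module with characteristic ideal `(G)` (`Module.charIdeal_eq_span_of_lengthAt_eq_quotient`), whose
`(T)`-length is `ord_T G` (`Kim2025.lengthAt_primeT_eq_order_of_charIdeal_eq_span`), and
`ord_T G = ord_T ι(G) = ord_T ι(L^•) = ord_T L^•` (`order_iwasawaToPowerSeries`, `order_C_mul_of_ne_zero`).
[cite: Washington1997, §13.2] [cite: MazurTateTeitelbaum1986, §I.12] -/
theorem lengthAt_quotient_primeT_eq_order {ϖ : ℚ} (hϖ0 : ϖ ≠ 0) {L G : IwasawaAlgebra p} (hL : L ≠ 0)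
    (hG : iwasawaToPowerSeries p G = PowerSeries.C ((ϖ : ℚ) : ℚ_[p]) * iwasawaToPowerSeries p L) :
    Module.lengthAt (IwasawaAlgebra p) (IwasawaAlgebra p ⧸ Ideal.span {G}) (primeT p) = L.order := by
  have hϖp : ((ϖ : ℚ) : ℚ_[p]) ≠ 0 := by exact_mod_cast hϖ0
  have hG0 : G ≠ 0 := by
    intro h0
    rw [h0, map_zero, eq_comm, mul_eq_zero] at hG
    rcases hG with hC | hL0
    · exact hϖp (by simpa using congrArg PowerSeries.constantCoeff hC)
    · exact hL (iwasawaToPowerSeries_injective p (by rw [hL0, map_zero]))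
  have hby : Module.IsTorsionBy (IwasawaAlgebra p) (IwasawaAlgebra p ⧸ Ideal.span {G}) G :=
    (Module.isTorsionBy_quotient_iff _ G).mpr fun y ↦ by
      rw [smul_eq_mul]
      exact Ideal.mul_mem_right y _ (Ideal.mem_span_singleton_self G)
  have htor : Module.IsTorsion (IwasawaAlgebra p) (IwasawaAlgebra p ⧸ Ideal.span {G}) :=
    fun x ↦ ⟨⟨G, mem_nonZeroDivisors_of_ne_zero hG0⟩, @hby x⟩
  have hchar : Module.charIdeal (IwasawaAlgebra p) (IwasawaAlgebra p ⧸ Ideal.span {G}) = Ideal.span {G} :=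
    Module.charIdeal_eq_span_of_lengthAt_eq_quotient hG0 fun _ _ ↦ rfl
  rw [Kim2025.lengthAt_primeT_eq_order_of_charIdeal_eq_span htor hchar, ← order_iwasawaToPowerSeries p G, hG,
    order_C_mul_of_ne_zero p hϖp, order_iwasawaToPowerSeries p L]

/-! ### §2 S4 at `(T)`, every rank, for a colour with `ord_T L^• ≤ rank E(ℚ)` -/

/-- **Stub S4 at `𝔭 ∋ T`, EVERY analytic rank, from `ord_{T=0} L^• ≤ rank E(ℚ)`.** Setting of Sprung 2012
Thm. 2.2 / Def. 7.11 over `ℚ`: `p ≠ 2` good with `p ∣ a_p` (any `a_p`, so `(3, ±3)` included), the cyclotomic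
datum `(κ, γ)`, the place `v ∣ p` with a local lift `g` of `γ`, a Honda system `(cneg, c)`; a newform `f` of
`W` with period ratio `ϖ` (`ϖ·Ω_W = Ω⁺_f`, so `ϖ ≠ 0`); a colour `•` with `L^• := chromaticL • L♯ L♭ ≠ 0` and a
Néron-normalised `G` (`ι G = C(ϖ)·ι L^•`); Sprung's REAL dual datum `D` of `Sel^•(E/ℚ_∞)` with `X^•` finitely
generated. IF `ord_{T=0} L^• ≤ rank E(ℚ)` (displayed), THEN at every height-one prime `𝔭 ∋ T` (that is `(T)`):
`ℓ_𝔭 Λ/(G) ≤ ℓ_𝔭 D.X` — because `ℓ_{(T)} Λ/(G) = ord_T L^• ≤ rank E(ℚ) ≤ ℓ_{(T)} X^•`, the last step being the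
Kummer brick `ChromaticCommonZeros.rat_mordellWeilRank_le_sharpFlat_lengthAt_primeT`. NO torsion hypothesis, NO GZK,
NO Kato divisibility, NO period unit. (The pair `(L♯, L♭)` enters only through the name `L^•`; no Sprung-pair
property is used.) [cite: GreenbergLNM1716, §1 p. 65 and §3 Lemma 3.1] [cite: Sprung2012, Def. 7.11 (p. 1503) and Prop. 7.19 (p. 1505)]
[cite: Sprung2024, §5.2 p. 39] [cite: Washington1997, §13.2] -/
theorem stub_cyclotomicLower_at_T_of_order_le_rank
    (W : WeierstrassCurve ℚ) [W.IsElliptic] [W.IsGloballyMinimal] (hp2 : p ≠ 2)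
    (hap : (p : ℤ) ∣ W.frobeniusTrace p)
    {κ : ZpExtension ℚ p} {γ : Field.absoluteGaloisGroup ℚ} (hγ : κ.IsTopGenerator γ)
    {v : HeightOneSpectrum (𝓞 ℚ)} {g : Field.absoluteGaloisGroup (v.adicCompletion ℚ)}
    (hg : κ.IsTopGenerator (resGalOfEmb (closureEmb (K := ℚ) (v.adicCompletion ℚ)) g))
    {cneg : localPoints W (v.adicCompletion ℚ)} {c : ℕ → localPoints W (v.adicCompletion ℚ)}
    (hH : IsHondaSystem κ (closureEmb (K := ℚ) (v.adicCompletion ℚ)) W (W.frobeniusTrace p) g cneg c)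
    {N : ℕ} [NeZero N] {f : CuspForm (Gamma0 N) 2} (hf : IsNewformOf W f)
    {ϖ : ℚ} (hϖ : (ϖ : ℝ) * W.realPeriodRat = plusPeriod f)
    {Lsharp Lflat : IwasawaAlgebra p} (col : Chroma) (hcol : chromaticL col Lsharp Lflat ≠ 0)
    (D : SharpFlatSelmerDualData W κ γ (closureEmb (K := ℚ) (v.adicCompletion ℚ)) (W.frobeniusTrace p) g c col)
    [Module.Finite (IwasawaAlgebra p) D.X] {G : IwasawaAlgebra p}
    (hG : iwasawaToPowerSeries p G =
      PowerSeries.C (ϖ : ℚ_[p]) * iwasawaToPowerSeries p (chromaticL col Lsharp Lflat))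
    (hord : (chromaticL col Lsharp Lflat).order ≤ (W.mordellWeilRank : ℕ∞))
    (𝔭 : PrimeSpectrum (IwasawaAlgebra p)) (h𝔭 : 𝔭.asIdeal.height = 1)
    (hT : (PowerSeries.X : IwasawaAlgebra p) ∈ 𝔭.asIdeal) :
    Module.lengthAt (IwasawaAlgebra p) (IwasawaAlgebra p ⧸ Ideal.span {G}) 𝔭 ≤
      Module.lengthAt (IwasawaAlgebra p) D.X 𝔭 := by
  -- `𝔭 = (T)`
  have h𝔭T : 𝔭 = primeT p :=
    PrimeSpectrum.ext (Ideal.eq_span_singleton_of_height_eq_one h𝔭 hT PowerSeries.X_prime)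
  subst h𝔭T
  -- `ϖ ≠ 0` since `Ω⁺_f > 0`
  have hϖ0 : ϖ ≠ 0 := by
    rintro rfl
    rw [Rat.cast_zero, zero_mul] at hϖ
    exact (IsNewform0.plusPeriod_pos_holds hf.1 hf.coeffField_eq_bot).ne hϖ
  rw [lengthAt_quotient_primeT_eq_order p hϖ0 hcol hG]
  exact hord.trans (ChromaticCommonZeros.rat_mordellWeilRank_le_sharpFlat_lengthAt_primeT W p hp2 hap hγ hg hH
    col D)

end Summit.BirchSwinnertonDyer.BirchSwinnertonDyer.Theorems.ChromaticCommonZerosOrderLeRank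

end
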